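import Summits.QuantumFields.YangMills.Theorems.UnitScaleTiltProp7LatticeBoxFriedrichsCov
import HarnessLib

/-!
# LANE II (B1″) — A CUTOFF TIMES A ONE-FORM: COVARIANT PRODUCT RULES AND THE H¹ ROW (ℤᵈ letters)

Item stmt-QuantumFields-19200 (`MinimiserStabilityRegPr`), LANE II «divergence recovery at curved `W`»; ★p1 g19 NAMER WORD №9 (3): the H¹ norms
(`CURL + DIV`) of the localised transverse remainders `ζ_i r_i` feed the (QH1) row of `Qkc`; pen px4 g7 (§4 box bricks, ★★OWNER RULING №23 (c)).
Tree letters of lit `B4Eq19LatticeOperators` (`Zd d`, `box z R`, `unitVec`), `R(u) := conjR u`, `V : Zd d → Fin d → (M_N(ℂ))ˣ` in `U1`.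

For a real cutoff `ζ` with `|ζ| ≤ 1`, bond oscillation `|ζ(y+e_μ) − ζ(y)| ≤ δ` and `supp ζ ⊆ Q_{R−1}(z)`, and a one-form `g` living on the edges of `Q_R(z)`,
put `h(y,μ) := ζ(y)·g(y,μ)`.  Then (§1) `curl_V h = ζ·curl_V g + (∂_μζ)·R(V y μ)g(y+e_μ,ν) − (∂_νζ)·R(V y ν)g(y+e_ν,μ)` and
`div_V h = ζ·div_V g + Σ_μ (ζ(y−e_μ) − ζ(y))·R(V(y−e_μ) μ)⁻¹g(y−e_μ,μ)`; (§3) ★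
`Σ_{Q_R}Σ_μΣ_ν‖curl_V h‖² + Σ_{Q_R}‖div_V h‖² ≤ 3·CURL_in(g) + 2·DIV_box(g) + 8d·δ²·Σ_{Q_R}Σ_μ‖g‖²`,
where `CURL_in`, `DIV_box` are EXACTLY the functionals of ✓`Prop7LatticeBoxFriedrichsCurved.sum_sq_le_box_friedrichs_plaq`, and the left side is the
full `ℤᵈ` curl∕divergence energy of `h` (every nonzero term has its base point in `Q_R(z)`).  Rung R3 brick; nothing about the YM gap is claimed.
-/

open scoped BigOperators Matrix.Norms.L2Operator
open Finset

namespace Summit.QuantumFields.YangMills.Theorems.Prop7LatticeCutoffOneForm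

open Literature.MathematicalPhysics.QuantumFieldTheory.Balaban1983to89
open Literature.MathematicalPhysics.QuantumFieldTheory.Balaban1983to89.B4Eq19LatticeOperators
open B7Prop1Explicit (U1)
open B7Eq78Linearization (conjR conjR_apply conjR_sub conjR_add conjR_smul)
open B8Ineq132 (norm_conjR)
open Summit.QuantumFields.YangMills.Theorems.Prop7LatticeBoxFriedrichsCov (sum_box_shift_le)

variable {d N : ℕ}

/-! ## §1 Product rules -/

/-- **CURL OF A CUTOFF ONE-FORM**: `curl_V(ζg)(y,μ,ν) = ζ(y)·curl_V g + (ζ(y+e_μ) − ζ y)·R(V y μ)g(y+e_μ,ν) − (ζ(y+e_ν) − ζ y)·R(V y ν)g(y+e_ν,μ)`. [folklore] -/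
theorem cutoff_curl_eq (V : Zd d → Fin d → (Matrix (Fin N) (Fin N) ℂ)ˣ) (ζ : Zd d → ℝ) (g : Zd d → Fin d → Matrix (Fin N) (Fin N) ℂ)
    (y : Zd d) (μ ν : Fin d) :
    ((ζ y : ℂ) • g y μ) + conjR (V y μ) (((ζ (y + unitVec μ) : ℝ) : ℂ) • g (y + unitVec μ) ν)
        - conjR (V y ν) (((ζ (y + unitVec ν) : ℝ) : ℂ) • g (y + unitVec ν) μ) - ((ζ y : ℂ) • g y ν)
      = (ζ y : ℂ) • (g y μ + conjR (V y μ) (g (y + unitVec μ) ν) - conjR (V y ν) (g (y + unitVec ν) μ) - g y ν)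
        + (((ζ (y + unitVec μ) - ζ y : ℝ)) : ℂ) • conjR (V y μ) (g (y + unitVec μ) ν)
        - (((ζ (y + unitVec ν) - ζ y : ℝ)) : ℂ) • conjR (V y ν) (g (y + unitVec ν) μ) := by
  rw [conjR_smul, conjR_smul]
  push_cast
  simp only [smul_add, smul_sub, sub_smul]
  abel

/-- **DIVERGENCE OF A CUTOFF ONE-FORM**: `div_V(ζg)(y) = ζ(y)·div_V g(y) + Σ_μ (ζ(y−e_μ) − ζ y)·R(V(y−e_μ) μ)⁻¹ g(y−e_μ,μ)`. [folklore] -/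
theorem cutoff_div_eq (V : Zd d → Fin d → (Matrix (Fin N) (Fin N) ℂ)ˣ) (ζ : Zd d → ℝ) (g : Zd d → Fin d → Matrix (Fin N) (Fin N) ℂ) (y : Zd d) :
    ∑ μ, (conjR (V (y - unitVec μ) μ)⁻¹ (((ζ (y - unitVec μ) : ℝ) : ℂ) • g (y - unitVec μ) μ) - (ζ y : ℂ) • g y μ)
      = (ζ y : ℂ) • ∑ μ, (conjR (V (y - unitVec μ) μ)⁻¹ (g (y - unitVec μ) μ) - g y μ)
        + ∑ μ, (((ζ (y - unitVec μ) - ζ y : ℝ)) : ℂ) • conjR (V (y - unitVec μ) μ)⁻¹ (g (y - unitVec μ) μ) := by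
  rw [Finset.smul_sum, ← Finset.sum_add_distrib]
  refine Finset.sum_congr rfl fun μ _ => ?_
  rw [conjR_smul]
  push_cast
  simp only [smul_sub, sub_smul]
  abel

/-! ## §2 Pointwise bounds -/

/-- `‖a•A + b•B − c•C‖² ≤ 3(a²‖A‖² + b²‖B‖² + c²‖C‖²)` for real scalars. [folklore] -/
theorem norm_sq_smul_three_le (a b c : ℝ) (A B C : Matrix (Fin N) (Fin N) ℂ) :
    ‖(a : ℂ) • A + (b : ℂ) • B - (c : ℂ) • C‖ ^ 2 ≤ 3 * (a ^ 2 * ‖A‖ ^ 2 + b ^ 2 * ‖B‖ ^ 2 + c ^ 2 * ‖C‖ ^ 2) := by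
  have h1 : ‖(a : ℂ) • A + (b : ℂ) • B - (c : ℂ) • C‖ ≤ ‖(a : ℂ) • A‖ + ‖(b : ℂ) • B‖ + ‖(c : ℂ) • C‖ :=
    (norm_sub_le _ _).trans (add_le_add (norm_add_le _ _) le_rfl)
  rw [norm_smul, norm_smul, norm_smul, Complex.norm_real, Complex.norm_real, Complex.norm_real,
    Real.norm_eq_abs, Real.norm_eq_abs, Real.norm_eq_abs] at h1
  have h0 : 0 ≤ |a| * ‖A‖ + |b| * ‖B‖ + |c| * ‖C‖ := by positivity
  have h2 := pow_le_pow_left₀ (norm_nonneg _) h1 2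
  have e : (|a| * ‖A‖ + |b| * ‖B‖ + |c| * ‖C‖) ^ 2 ≤ 3 * (a ^ 2 * ‖A‖ ^ 2 + b ^ 2 * ‖B‖ ^ 2 + c ^ 2 * ‖C‖ ^ 2) := by
    rw [← sq_abs a, ← sq_abs b, ← sq_abs c]
    nlinarith [sq_nonneg (|a| * ‖A‖ - |b| * ‖B‖), sq_nonneg (|b| * ‖B‖ - |c| * ‖C‖), sq_nonneg (|a| * ‖A‖ - |c| * ‖C‖)]
  exact h2.trans e

/-- `‖a•A + Σ_μ b_μ•B_μ‖² ≤ 2a²‖A‖² + 2d·Σ_μ b_μ²‖B_μ‖²`. [folklore] -/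
theorem norm_sq_smul_add_sum_le (a : ℝ) (A : Matrix (Fin N) (Fin N) ℂ) (b : Fin d → ℝ) (B : Fin d → Matrix (Fin N) (Fin N) ℂ) :
    ‖(a : ℂ) • A + ∑ μ, (b μ : ℂ) • B μ‖ ^ 2 ≤ 2 * (a ^ 2 * ‖A‖ ^ 2) + 2 * d * ∑ μ, b μ ^ 2 * ‖B μ‖ ^ 2 := by
  have h1 : ‖(a : ℂ) • A + ∑ μ, (b μ : ℂ) • B μ‖ ≤ |a| * ‖A‖ + ∑ μ, |b μ| * ‖B μ‖ := by
    refine (norm_add_le _ _).trans (add_le_add ?_ ?_)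
    · rw [norm_smul, Complex.norm_real, Real.norm_eq_abs]
    · refine (norm_sum_le _ _).trans (Finset.sum_le_sum fun μ _ => ?_)
      rw [norm_smul, Complex.norm_real, Real.norm_eq_abs]
  have hS : 0 ≤ ∑ μ, |b μ| * ‖B μ‖ := Finset.sum_nonneg fun μ _ => by positivity
  have h2 := pow_le_pow_left₀ (norm_nonneg _) h1 2
  have hcs : (∑ μ, |b μ| * ‖B μ‖) ^ 2 ≤ d * ∑ μ, b μ ^ 2 * ‖B μ‖ ^ 2 := by
    have h := sq_sum_le_card_mul_sum_sq (s := (Finset.univ : Finset (Fin d))) (f := fun μ => |b μ| * ‖B μ‖)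
    rw [Finset.card_univ, Fintype.card_fin] at h
    refine h.trans (le_of_eq ?_)
    congr 1
    refine Finset.sum_congr rfl fun μ _ => ?_
    rw [mul_pow, sq_abs]
  have hd : (0 : ℝ) ≤ d := Nat.cast_nonneg _
  nlinarith [sq_nonneg (|a| * ‖A‖ - ∑ μ, |b μ| * ‖B μ‖), sq_abs a]

/-! ## §3 The H¹ row of a cutoff one-form -/

/-- A point of `Q_{R−1}(z)` plus two DISTINCT unit vectors lies in `Q_R(z)`. [folklore] -/
theorem add_two_unitVec_mem_box {z y : Zd d} {R : ℤ} (hy : y ∈ box z (R - 1)) {μ ν : Fin d} (hμν : μ ≠ ν) :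
    y + unitVec μ + unitVec ν ∈ box z R := by
  rw [mem_box] at hy ⊢
  intro i
  have h := hy i
  have hμi : (unitVec μ : Zd d) i = if i = μ then 1 else 0 := by simp [unitVec, Pi.single_apply]
  have hνi : (unitVec ν : Zd d) i = if i = ν then 1 else 0 := by simp [unitVec, Pi.single_apply]
  simp only [Pi.add_apply, hμi, hνi]
  rw [abs_le] at h ⊢
  constructor <;> split_ifs <;> omega

/-- ★★ **THE H¹ ROW OF A CUTOFF ONE-FORM** (NAMER WORD №9 «(B1″)»): `V ∈ U1`, `|ζ| ≤ 1`, `|ζ(y+e_μ) − ζ y| ≤ δ`, `supp ζ ⊆ Q_{R−1}(z)`, `g` on the edges of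
`Q_R(z)`, `h := ζ·g`:
`Σ_{Q_R}Σ_μΣ_ν‖curl_V h(y,μ,ν)‖² + Σ_{Q_R}‖div_V h(y)‖² ≤ 3·CURL_in(g) + 2·DIV_box(g) + 8d·δ²·Σ_{Q_R}Σ_μ‖g y μ‖²`
(`CURL_in(g) = Σ_{Q_R}Σ_μΣ_ν [y+e_μ+e_ν ∈ Q_R]‖g y μ + R(V y μ)g(y+e_μ) ν − R(V y ν)g(y+e_ν) μ − g y ν‖²`, `DIV_box(g) = Σ_{Q_R}‖Σ_μ (R(V(y−e_μ) μ)⁻¹g(y−e_μ) μ − g y μ)‖²`).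
[cite: Balaban1985BackgroundPropagators, (3.10) p.392; folklore (product rule)] -/
theorem cutoff_curl_div_le [NeZero N] {z : Zd d} {R : ℤ} {δ : ℝ}
    (V : Zd d → Fin d → (Matrix (Fin N) (Fin N) ℂ)ˣ) (hV : ∀ y μ, V y μ ∈ U1 (Matrix (Fin N) (Fin N) ℂ))
    (ζ : Zd d → ℝ) (hζ1 : ∀ y, |ζ y| ≤ 1) (hζδ : ∀ (y : Zd d) (μ : Fin d), |ζ (y + unitVec μ) - ζ y| ≤ δ)
    (hζs : ∀ y ∉ box z (R - 1), ζ y = 0)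
    (g : Zd d → Fin d → Matrix (Fin N) (Fin N) ℂ) (hg : ∀ (y : Zd d) (μ : Fin d), (y ∉ box z R ∨ y + unitVec μ ∉ box z R) → g y μ = 0) :
    ∑ y ∈ box z R, ∑ μ, ∑ ν,
        ‖((ζ y : ℂ) • g y μ) + conjR (V y μ) (((ζ (y + unitVec μ) : ℝ) : ℂ) • g (y + unitVec μ) ν)
          - conjR (V y ν) (((ζ (y + unitVec ν) : ℝ) : ℂ) • g (y + unitVec ν) μ) - ((ζ y : ℂ) • g y ν)‖ ^ 2
      + ∑ y ∈ box z R, ‖∑ μ, (conjR (V (y - unitVec μ) μ)⁻¹ (((ζ (y - unitVec μ) : ℝ) : ℂ) • g (y - unitVec μ) μ) - (ζ y : ℂ) • g y μ)‖ ^ 2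
      ≤ 3 * ∑ y ∈ box z R, ∑ μ, ∑ ν,
            (if y + unitVec μ + unitVec ν ∈ box z R then ‖g y μ + conjR (V y μ) (g (y + unitVec μ) ν) - conjR (V y ν) (g (y + unitVec ν) μ) - g y ν‖ ^ 2 else 0)
        + 2 * ∑ y ∈ box z R, ‖∑ μ, (conjR (V (y - unitVec μ) μ)⁻¹ (g (y - unitVec μ) μ) - g y μ)‖ ^ 2
        + 8 * d * δ ^ 2 * ∑ y ∈ box z R, ∑ μ, ‖g y μ‖ ^ 2 := by
  -- ### the curl part
  have hcurl : ∀ y ∈ box z R, ∀ μ ν : Fin d,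
      ‖((ζ y : ℂ) • g y μ) + conjR (V y μ) (((ζ (y + unitVec μ) : ℝ) : ℂ) • g (y + unitVec μ) ν)
          - conjR (V y ν) (((ζ (y + unitVec ν) : ℝ) : ℂ) • g (y + unitVec ν) μ) - ((ζ y : ℂ) • g y ν)‖ ^ 2
        ≤ 3 * (if y + unitVec μ + unitVec ν ∈ box z R then
              ‖g y μ + conjR (V y μ) (g (y + unitVec μ) ν) - conjR (V y ν) (g (y + unitVec ν) μ) - g y ν‖ ^ 2 else 0)
          + 3 * δ ^ 2 * ‖g (y + unitVec μ) ν‖ ^ 2 + 3 * δ ^ 2 * ‖g (y + unitVec ν) μ‖ ^ 2 := by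
    intro y hy μ ν
    rw [cutoff_curl_eq]
    refine (norm_sq_smul_three_le _ _ _ _ _ _).trans ?_
    rw [norm_conjR (hV y μ), norm_conjR (hV y ν)]
    have hb : (ζ (y + unitVec μ) - ζ y) ^ 2 ≤ δ ^ 2 := by
      rw [← sq_abs]; exact pow_le_pow_left₀ (abs_nonneg _) (hζδ y μ) 2
    have hc : (ζ (y + unitVec ν) - ζ y) ^ 2 ≤ δ ^ 2 := by
      rw [← sq_abs]; exact pow_le_pow_left₀ (abs_nonneg _) (hζδ y ν) 2
    have ha : ζ y ^ 2 * ‖g y μ + conjR (V y μ) (g (y + unitVec μ) ν) - conjR (V y ν) (g (y + unitVec ν) μ) - g y ν‖ ^ 2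
        ≤ (if y + unitVec μ + unitVec ν ∈ box z R then
            ‖g y μ + conjR (V y μ) (g (y + unitVec μ) ν) - conjR (V y ν) (g (y + unitVec ν) μ) - g y ν‖ ^ 2 else 0) := by
      by_cases hμν : μ = ν
      · subst hμν
        have : g y μ + conjR (V y μ) (g (y + unitVec μ) μ) - conjR (V y μ) (g (y + unitVec μ) μ) - g y μ = 0 := by abel
        rw [this, norm_zero]; simp
      · by_cases hζ0 : ζ y = 0
        · rw [hζ0]; simp only [ne_eq, OfNat.ofNat_ne_zero, not_false_eq_true, zero_pow, zero_mul]
          split_ifs <;> positivity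
        · have hyR : y ∈ box z (R - 1) := by by_contra h'; exact hζ0 (hζs y h')
          rw [if_pos (add_two_unitVec_mem_box hyR hμν)]
          have h1 : ζ y ^ 2 ≤ 1 := by
            have := hζ1 y; rw [← sq_abs]; nlinarith [abs_nonneg (ζ y)]
          have h0 : 0 ≤ ‖g y μ + conjR (V y μ) (g (y + unitVec μ) ν) - conjR (V y ν) (g (y + unitVec ν) μ) - g y ν‖ ^ 2 := by positivity
          nlinarith
    have hB0 : 0 ≤ ‖g (y + unitVec μ) ν‖ ^ 2 := by positivity
    have hC0 : 0 ≤ ‖g (y + unitVec ν) μ‖ ^ 2 := by positivity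
    nlinarith [mul_le_mul_of_nonneg_right hb hB0, mul_le_mul_of_nonneg_right hc hC0]
  -- ### the divergence part
  have hdiv : ∀ y ∈ box z R,
      ‖∑ μ, (conjR (V (y - unitVec μ) μ)⁻¹ (((ζ (y - unitVec μ) : ℝ) : ℂ) • g (y - unitVec μ) μ) - (ζ y : ℂ) • g y μ)‖ ^ 2
        ≤ 2 * ‖∑ μ, (conjR (V (y - unitVec μ) μ)⁻¹ (g (y - unitVec μ) μ) - g y μ)‖ ^ 2
          + 2 * d * δ ^ 2 * ∑ μ, ‖g (y - unitVec μ) μ‖ ^ 2 := by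
    intro y hy
    rw [cutoff_div_eq]
    refine (norm_sq_smul_add_sum_le _ _ _ _).trans ?_
    have h1 : ζ y ^ 2 ≤ 1 := by
      have := hζ1 y; rw [← sq_abs]; nlinarith [abs_nonneg (ζ y)]
    have hA0 : 0 ≤ ‖∑ μ, (conjR (V (y - unitVec μ) μ)⁻¹ (g (y - unitVec μ) μ) - g y μ)‖ ^ 2 := by positivity
    have h2 : ∑ μ, (ζ (y - unitVec μ) - ζ y) ^ 2 * ‖conjR (V (y - unitVec μ) μ)⁻¹ (g (y - unitVec μ) μ)‖ ^ 2
        ≤ δ ^ 2 * ∑ μ, ‖g (y - unitVec μ) μ‖ ^ 2 := by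
      rw [Finset.mul_sum]
      refine Finset.sum_le_sum fun μ _ => ?_
      rw [norm_conjR ((U1 _).inv_mem (hV _ _))]
      have hb : (ζ (y - unitVec μ) - ζ y) ^ 2 ≤ δ ^ 2 := by
        rw [← sq_abs, abs_sub_comm]
        have := hζδ (y - unitVec μ) μ
        rw [sub_add_cancel] at this
        exact pow_le_pow_left₀ (abs_nonneg _) this 2
      exact mul_le_mul_of_nonneg_right hb (by positivity)
    have hd : (0 : ℝ) ≤ d := Nat.cast_nonneg _
    nlinarith [mul_le_mul_of_nonneg_left h2 (by positivity : (0 : ℝ) ≤ 2 * d)]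
  -- ### summation and the shifts
  have hG0 : ∀ y, 0 ≤ ∑ ν, ‖g y ν‖ ^ 2 := fun y => Finset.sum_nonneg fun ν _ => by positivity
  have hGs : ∀ y ∉ box z R, ∑ ν, ‖g y ν‖ ^ 2 = 0 := by
    intro y hy; exact Finset.sum_eq_zero fun ν _ => by rw [hg y ν (Or.inl hy), norm_zero]; simp
  have hshift1 : ∑ y ∈ box z R, ∑ μ, ∑ ν, ‖g (y + unitVec μ) ν‖ ^ 2 ≤ d * ∑ y ∈ box z R, ∑ μ, ‖g y μ‖ ^ 2 := by
    rw [Finset.sum_comm]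
    calc ∑ μ, ∑ y ∈ box z R, ∑ ν, ‖g (y + unitVec μ) ν‖ ^ 2 ≤ ∑ μ : Fin d, ∑ y ∈ box z R, ∑ ν, ‖g y ν‖ ^ 2 :=
          Finset.sum_le_sum fun μ _ => sum_box_shift_le (H := fun y => ∑ ν, ‖g y ν‖ ^ 2) hG0 hGs (unitVec μ)
      _ = d * ∑ y ∈ box z R, ∑ μ, ‖g y μ‖ ^ 2 := by rw [Finset.sum_const, Finset.card_univ, Fintype.card_fin, nsmul_eq_mul]
  have hshift2 : ∑ y ∈ box z R, ∑ μ, ∑ ν, ‖g (y + unitVec ν) μ‖ ^ 2 ≤ d * ∑ y ∈ box z R, ∑ μ, ‖g y μ‖ ^ 2 := by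
    have e : ∑ y ∈ box z R, ∑ μ, ∑ ν, ‖g (y + unitVec ν) μ‖ ^ 2 = ∑ y ∈ box z R, ∑ μ, ∑ ν, ‖g (y + unitVec μ) ν‖ ^ 2 :=
      Finset.sum_congr rfl fun y _ => Finset.sum_comm
    rw [e]; exact hshift1
  have hGμ0 : ∀ (μ : Fin d) (y : Zd d), 0 ≤ ‖g y μ‖ ^ 2 := fun μ y => by positivity
  have hGμs : ∀ (μ : Fin d), ∀ y ∉ box z R, ‖g y μ‖ ^ 2 = 0 := by
    intro μ y hy; rw [hg y μ (Or.inl hy), norm_zero]; simp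
  have hshift3 : ∑ y ∈ box z R, ∑ μ, ‖g (y - unitVec μ) μ‖ ^ 2 ≤ ∑ y ∈ box z R, ∑ μ, ‖g y μ‖ ^ 2 := by
    rw [Finset.sum_comm, Finset.sum_comm (s := box z R)]
    refine Finset.sum_le_sum fun μ _ => ?_
    have h := sum_box_shift_le (z := z) (R := R) (H := fun y => ‖g y μ‖ ^ 2) (hGμ0 μ) (hGμs μ) (-unitVec μ)
    simpa [sub_eq_add_neg] using h
  -- assemble
  have hsumC := Finset.sum_le_sum fun y hy => Finset.sum_le_sum fun μ (_ : μ ∈ Finset.univ) =>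
    Finset.sum_le_sum fun ν (_ : ν ∈ Finset.univ) => hcurl y hy μ ν
  have hsumD := Finset.sum_le_sum fun y hy => hdiv y hy
  refine (add_le_add hsumC hsumD).trans ?_
  simp only [Finset.sum_add_distrib, ← Finset.mul_sum]
  have hd : (0 : ℝ) ≤ d := Nat.cast_nonneg _
  have hδ2 : 0 ≤ δ ^ 2 := by positivity
  nlinarith [mul_le_mul_of_nonneg_left hshift1 hδ2, mul_le_mul_of_nonneg_left hshift2 hδ2,
    mul_le_mul_of_nonneg_left hshift3 (by positivity : (0 : ℝ) ≤ 2 * d * δ ^ 2)]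

end Summit.QuantumFields.YangMills.Theorems.Prop7LatticeCutoffOneForm
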